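import Literature.NumberTheory.NumberFields.ClassGroupNormKernelOneRamifiedPrime
import HarnessLib

/-!
# One totally ramified prime in a tower `B ⊆ F ⊆ F'`: the hypothesis «`e(𝔓' | B) = [F' : B]`, every other prime unramified» DESCENDS to
# `F'/F` and to `F/B` (bookkeeping for the layers `K_k ⊆ K_j ⊆ K_m` of a `ℤ_p`-tower with one totally ramified prime), and with it
# Iwasawa's `ker N = I_G Cl` for every intermediate pair

Topic `NumberTheory/NumberFields` (namespace = path, grouping sub-namespace `ClassGroupNormKernel`).  THEOREM-ONLY file (no definition, no named fact,
no `sorry`), written by the prover seat `bsd-wall-rtt-p4-w2` g20 (cell `bsd-wall`; `--supports` stmt-BirchSwinnertonDyer-21438, line `nonsquare-descent`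
stub S2; closes nothing; BSD is proved for no curve here).  Sequel of `ClassGroupNormKernelOneRamifiedPrime.lean`, whose theorems take, for ONE pair
`B ⊆ F`, a prime `𝔓` of `F` with `e(𝔓 | B) = [F : B]` and `Q.ramificationIdx (𝓞 B) ≠ 1 → Q = 𝔓`.  Along a tower one verifies this ONCE, at the top:

* **`ramificationIdx_eq_finrank_top`**, **`ramificationIdx_under_eq_finrank_bot`** — `B ⊆ F ⊆ F'` number fields, `F'/B` and `F/B` Galois, `𝔓'` a prime of
  `F'` with `e(𝔓' | B) = [F' : B]`: then `e(𝔓' | F) = [F' : F]` and `e(𝔓' ∩ F | B) = [F : B]` (`e` is multiplicative in towers, Mathlib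
  `Ideal.ramificationIdx_tower`, and divides the degree in a Galois extension, Mathlib `Ideal.ncard_primesOver_mul_ramificationIdxIn_mul_inertiaDegIn`).
* **`eq_top_of_ramificationIdx_ne_one_top`**, **`eq_under_of_ramificationIdx_ne_one_bot`** — if moreover every prime `Q' ≠ 𝔓'` of `F'` is unramified
  over `B`, then every prime of `F'` ramified over `F` is `𝔓'`, and every prime of `F` ramified over `B` is `𝔓' ∩ F`.
* **`ker_classGroupNorm_eq_closure_top`**, **`ker_classGroupNorm_eq_closure_bot`** — hence (with `F'/B` unramified at the infinite places, Mathlib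
  `IsUnramifiedAtInfinitePlaces.top/.bot`) `ker N_{F'/F} = I_{Gal(F'/F)} Cl(F')` and `ker N_{F/B} = I_{Gal(F/B)} Cl(F)`
  (`ker_classGroupNorm_eq_closure_of_ramificationIdx_eq_finrank`).

References: [Washington1997] §13.3 Lemma 13.15, Prop. 13.22 (the standing assumption «all primes which ramify in `K_∞/K_n` are totally ramified»,
read between any two layers); [Lang1990] Ch. 5 §4 Thm. 4.1 and Corollary (held, PDF p. 104); [NeukirchANT1999] Ch. I §9 (9.1), Ch. II (9.6).
-/

noncomputable section

open NumberField IsDedekindDomain Ideal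

namespace Literature.NumberTheory.NumberFields

namespace ClassGroupNormKernel

/-- `a ∣ A`, `b ∣ B`, `a · b = A · B ≠ 0` force `a = A` and `b = B`. [folklore] -/
private theorem eq_of_dvd_of_dvd_of_mul_eq_mul {a b A B : ℕ} (ha : a ∣ A) (hb : b ∣ B) (h : a * b = A * B) (hAB : A * B ≠ 0) :
    a = A ∧ b = B := by
  obtain ⟨k, rfl⟩ := ha
  obtain ⟨l, rfl⟩ := hb
  have hab : a * b ≠ 0 := by rw [h]; exact hAB
  have hkl : k * l = 1 := by
    have h' : a * b * (k * l) = a * b * 1 := by rw [mul_one, mul_mul_mul_comm, ← h]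
    exact Nat.eq_of_mul_eq_mul_left (Nat.pos_of_ne_zero hab) h'
  rw [Nat.eq_one_of_mul_eq_one_right hkl, Nat.eq_one_of_mul_eq_one_left hkl, mul_one, mul_one]
  exact ⟨rfl, rfl⟩

variable {B F F' : Type} [Field B] [NumberField B] [Field F] [NumberField F] [Field F'] [NumberField F']
  [Algebra B F] [Algebra F F'] [Algebra B F'] [IsScalarTower B F F'] [IsGalois B F'] [IsGalois B F]

omit [IsGalois B F'] in
/-- In a Galois extension the ramification index of a prime divides the degree (`r · e · f = [F : B]`, Mathlib
`Ideal.ncard_primesOver_mul_ramificationIdxIn_mul_inertiaDegIn`). [cite: NeukirchANT1999, Ch. I §9 (9.1) and Ch. II (9.6)] [folklore] -/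
theorem ramificationIdx_dvd_finrank (Q : Ideal (𝓞 F)) [Q.IsMaximal] : Q.ramificationIdx (𝓞 B) ∣ Module.finrank B F := by
  have hQ0 : Q ≠ ⊥ := Ring.ne_bot_of_isMaximal_of_not_isField ‹_› (RingOfIntegers.not_isField F)
  haveI : (Q.under (𝓞 B)).IsMaximal := Ideal.IsMaximal.under (𝓞 B) Q
  have h := Ideal.ncard_primesOver_mul_ramificationIdxIn_mul_inertiaDegIn (Q.under (𝓞 B)) (𝓞 F) (F ≃ₐ[B] F)
  rw [IsGalois.card_aut_eq_finrank, Ideal.ramificationIdxIn_eq_ramificationIdx (Q.under (𝓞 B)) Q (F ≃ₐ[B] F)] at h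
  exact ⟨(Ideal.primesOver (Q.under (𝓞 B)) (𝓞 F)).ncard * (Q.under (𝓞 B)).inertiaDegIn (𝓞 F), by rw [← h]; ring⟩

/-- **Descent of total ramification, both layers at once**: `B ⊆ F ⊆ F'`, `F'/B` and `F/B` Galois, `e(𝔓' | B) = [F' : B]` ⟹
`e(𝔓' ∩ F | B) = [F : B]` and `e(𝔓' | F) = [F' : F]`. [cite: Washington1997, §13.3 (before Lemma 13.15)] [folklore] -/
theorem ramificationIdx_under_eq_and_eq (𝔓' : Ideal (𝓞 F')) [𝔓'.IsMaximal] (h𝔓' : 𝔓'.ramificationIdx (𝓞 B) = Module.finrank B F') :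
    (𝔓'.under (𝓞 F)).ramificationIdx (𝓞 B) = Module.finrank B F ∧ 𝔓'.ramificationIdx (𝓞 F) = Module.finrank F F' := by
  haveI : IsGalois F F' := IsGalois.tower_top_of_isGalois B F F'
  haveI : (𝔓'.under (𝓞 F)).IsMaximal := Ideal.IsMaximal.under (𝓞 F) 𝔓'
  have htower := Ideal.ramificationIdx_tower (R := 𝓞 B) (𝔓'.under (𝓞 F)) 𝔓'
  refine eq_of_dvd_of_dvd_of_mul_eq_mul (ramificationIdx_dvd_finrank (B := B) (𝔓'.under (𝓞 F)))
    (ramificationIdx_dvd_finrank (B := F) 𝔓') ?_ (Nat.mul_ne_zero Module.finrank_pos.ne' Module.finrank_pos.ne')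
  rw [← htower, h𝔓', Module.finrank_mul_finrank]

/-- **`e(𝔓' | F) = [F' : F]`**: the totally ramified prime of `F'/B` is totally ramified over the intermediate field `F`.
[cite: Washington1997, §13.3 (before Lemma 13.15)] [folklore] -/
theorem ramificationIdx_eq_finrank_top (𝔓' : Ideal (𝓞 F')) [𝔓'.IsMaximal] (h𝔓' : 𝔓'.ramificationIdx (𝓞 B) = Module.finrank B F') :
    𝔓'.ramificationIdx (𝓞 F) = Module.finrank F F' :=
  (ramificationIdx_under_eq_and_eq 𝔓' h𝔓').2

/-- **`e(𝔓' ∩ F | B) = [F : B]`**: the prime of the intermediate field below the totally ramified prime is totally ramified over `B`.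
[cite: Washington1997, §13.3 (before Lemma 13.15)] [folklore] -/
theorem ramificationIdx_under_eq_finrank_bot (𝔓' : Ideal (𝓞 F')) [𝔓'.IsMaximal] (h𝔓' : 𝔓'.ramificationIdx (𝓞 B) = Module.finrank B F') :
    (𝔓'.under (𝓞 F)).ramificationIdx (𝓞 B) = Module.finrank B F :=
  (ramificationIdx_under_eq_and_eq 𝔓' h𝔓').1

omit [NumberField B] [NumberField F'] [IsGalois B F'] [IsGalois B F] in
/-- **A prime of `F'` ramified over `F` is ramified over `B`**, hence equals `𝔓'` when `𝔓'` is the only prime of `F'` ramified over `B` (`e` is multiplicative in towers).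
[cite: Washington1997, §13.3 (before Lemma 13.15: ramification between the layers `K_n ⊆ K_m ⊆ K_∞`)] -/
theorem eq_top_of_ramificationIdx_ne_one_top (𝔓' : Ideal (𝓞 F')) [𝔓'.IsMaximal]
    (huniq' : ∀ (Q' : Ideal (𝓞 F')) [Q'.IsMaximal], Q'.ramificationIdx (𝓞 B) ≠ 1 → Q' = 𝔓')
    (Q' : Ideal (𝓞 F')) [Q'.IsMaximal] (hQ' : Q'.ramificationIdx (𝓞 F) ≠ 1) : Q' = 𝔓' := by
  haveI : (Q'.under (𝓞 F)).IsMaximal := Ideal.IsMaximal.under (𝓞 F) Q'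
  refine huniq' Q' fun h1 => hQ' ?_
  have htower := Ideal.ramificationIdx_tower (R := 𝓞 B) (Q'.under (𝓞 F)) Q'
  rw [h1] at htower
  exact (Nat.eq_one_of_mul_eq_one_left htower.symm)

omit [NumberField B] [NumberField F'] [IsGalois B F'] [IsGalois B F] in
/-- **A prime of `F` ramified over `B` lies under `𝔓'`** when `𝔓'` is the only prime of `F'` ramified over `B`: every prime of `F` ramified over `B` is
`𝔓' ∩ F` (`e` is multiplicative in towers). [cite: Washington1997, §13.3 (before Lemma 13.15: ramification between the layers `K_n ⊆ K_m ⊆ K_∞`)] -/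
theorem eq_under_of_ramificationIdx_ne_one_bot (𝔓' : Ideal (𝓞 F')) [𝔓'.IsMaximal]
    (huniq' : ∀ (Q' : Ideal (𝓞 F')) [Q'.IsMaximal], Q'.ramificationIdx (𝓞 B) ≠ 1 → Q' = 𝔓')
    (Q : Ideal (𝓞 F)) [Q.IsMaximal] (hQ : Q.ramificationIdx (𝓞 B) ≠ 1) : Q = 𝔓'.under (𝓞 F) := by
  obtain ⟨Q', hQ'max, hQ'Q⟩ := Ideal.exists_maximal_ideal_liesOver_of_isIntegral (S := 𝓞 F') Q
  haveI := hQ'max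
  haveI := hQ'Q
  have htower := Ideal.ramificationIdx_tower (R := 𝓞 B) Q Q'
  have hne : Q'.ramificationIdx (𝓞 B) ≠ 1 := by
    rw [htower]
    intro h1
    exact hQ (Nat.eq_one_of_mul_eq_one_right h1)
  have hQ'eq : Q' = 𝔓' := huniq' Q' hne
  rw [hQ'Q.over, hQ'eq]

/-- **`ker N_{F'/F} = I_{Gal(F'/F)} Cl(F')` for the top layer** of a tower `B ⊆ F ⊆ F'` (`F'/B`, `F/B` Galois, `F'/B` unramified at the infinite
places) in which one prime `𝔓'` of `F'` is totally ramified over `B` and every other prime of `F'` is unramified over `B`.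
[cite: Washington1997, §13.3 Lemma 13.15 and Prop. 13.22] [cite: Lang1990, Ch. 5 §4, Thm. 4.1 and Corollary] -/
theorem ker_classGroupNorm_eq_closure_top [IsUnramifiedAtInfinitePlaces B F'] (𝔓' : Ideal (𝓞 F')) [𝔓'.IsMaximal]
    (h𝔓' : 𝔓'.ramificationIdx (𝓞 B) = Module.finrank B F')
    (huniq' : ∀ (Q' : Ideal (𝓞 F')) [Q'.IsMaximal], Q'.ramificationIdx (𝓞 B) ≠ 1 → Q' = 𝔓') :
    (classGroupNorm F F').ker = Subgroup.closure {x : ClassGroup (𝓞 F') | ∃ (τ : F' ≃ₐ[F] F') (d : ClassGroup (𝓞 F')),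
      x = ClassGroup.mulEquiv (AmbiguousClass.intAut τ) d / d} := by
  haveI : IsGalois F F' := IsGalois.tower_top_of_isGalois B F F'
  haveI : IsUnramifiedAtInfinitePlaces F F' := IsUnramifiedAtInfinitePlaces.top B F F'
  exact ker_classGroupNorm_eq_closure_of_ramificationIdx_eq_finrank 𝔓' (ramificationIdx_eq_finrank_top 𝔓' h𝔓')
    (fun Q' _ hQ' => eq_top_of_ramificationIdx_ne_one_top 𝔓' huniq' Q' hQ')

/-- **`ker N_{F/B} = I_{Gal(F/B)} Cl(F)` for the bottom layer** of a tower `B ⊆ F ⊆ F'` as above (the ramified prime of `F` is `𝔓' ∩ F`).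
[cite: Washington1997, §13.3 Lemma 13.15 and Prop. 13.22] [cite: Lang1990, Ch. 5 §4, Thm. 4.1 and Corollary] -/
theorem ker_classGroupNorm_eq_closure_bot [IsUnramifiedAtInfinitePlaces B F'] (𝔓' : Ideal (𝓞 F')) [𝔓'.IsMaximal]
    (h𝔓' : 𝔓'.ramificationIdx (𝓞 B) = Module.finrank B F')
    (huniq' : ∀ (Q' : Ideal (𝓞 F')) [Q'.IsMaximal], Q'.ramificationIdx (𝓞 B) ≠ 1 → Q' = 𝔓') :
    (classGroupNorm B F).ker = Subgroup.closure {x : ClassGroup (𝓞 F) | ∃ (τ : F ≃ₐ[B] F) (d : ClassGroup (𝓞 F)),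
      x = ClassGroup.mulEquiv (AmbiguousClass.intAut τ) d / d} := by
  haveI : Algebra.IsAlgebraic B F' := Algebra.IsAlgebraic.of_finite B F'
  haveI : IsUnramifiedAtInfinitePlaces B F := IsUnramifiedAtInfinitePlaces.bot B F (F := F')
  haveI : (𝔓'.under (𝓞 F)).IsMaximal := Ideal.IsMaximal.under (𝓞 F) 𝔓'
  exact ker_classGroupNorm_eq_closure_of_ramificationIdx_eq_finrank (𝔓'.under (𝓞 F)) (ramificationIdx_under_eq_finrank_bot 𝔓' h𝔓')
    (fun Q _ hQ => eq_under_of_ramificationIdx_ne_one_bot 𝔓' huniq' Q hQ)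

end ClassGroupNormKernel

end Literature.NumberTheory.NumberFields

end
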